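import Literature.NumberTheory.EllipticCurves.CuspFormTwist
import Literature.NumberTheory.EllipticCurves.Gamma1PeriodLatticeTwistProofs
import Literature.NumberTheory.EllipticCurves.CuspFormLFunction
import Literature.NumberTheory.EllipticCurves.NewformPeterssonSizeSymmSquareProofs
import Literature.NumberTheory.EllipticCurves.ModularityVersionAp
import Literature.NumberTheory.EllipticCurves.Gamma0CuspFormQSeriesBounds
import Literature.NumberTheory.EllipticCurves.ModularCurve
import HarnessLib

/-!
# Route `TeichmullerTwistDescent`, crux K `TwistedPeriodLatticeSaturation` (stmt-BirchSwinnertonDyer-25368) —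
# the INDEX FRAME `m · Λ(f) ⊆ g(χ) · Λ(f ⊗ χ) ⊆ Λ(f)` (helper, `--supports`; route-independent)

Cell `pub/bsd-wall`, seat `bsd-line-ttd-p1` g4. THEOREMS ONLY (no `sorry`, no new definition, no named fact).

For a cusp form `f ∈ S_k(Γ₀(N))`, a primitive quadratic Dirichlet character `χ` mod `m` with `m² ∣ N`,
and the twist `f ⊗ χ = charTwist N _ _ hχ f ∈ S_k(Γ₀(N))` (Shimura 1971 Prop. 3.64, tree `charTwist`):

* `charTwist_charTwist_eq_self_of_cuspCoeff_eq_zero` — **the twist is an involution on forms whose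
  coefficients vanish off the units mod `m`**: `(f ⊗ χ) ⊗ χ = f` (both sides have `q`-expansion
  `∑ χ(n)² aₙ qⁿ = ∑ aₙ qⁿ`, `q`-expansion principle `eq_of_forall_cuspCoeff_eq_gamma0`);
* `cuspCoeff_eq_zero_of_isNewform0_of_sq_dvd_of_dvd` — for a weight-2 NEWFORM of level `N` with `p² ∣ N`, `aₙ(f) = 0`
  whenever `p ∣ n` (Atkin–Lehner 1970 Thm. 3, `a_p = 0`, with multiplicativity), so the involution applies to
  the newform of a curve additive at `p` and `χ` mod `p`;
* `natCast_mul_mem_gaussSum_mul_periodLattice_charTwist` — **the index frame**: in weight 2 and for `χ` mod a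
  prime `p` with `p² ∣ N`, `p · Λ(f) ⊆ g(χ) · Λ(f ⊗ χ)`; together with the tree's twisting lemma
  `gaussSum_mul_mem_periodLattice_of_mem_charTwist` (`g(χ) · Λ(f ⊗ χ) ⊆ Λ(f)`, Stevens 1989 (5.4)) this pins
  the index `[Λ(f) : g(χ)Λ(f ⊗ χ)]` to a divisor of `p²` (proof: apply the twisting lemma to `f ⊗ χ`, whose
  twist is `f`, and use `g(χ)² = χ(−1) p`, Mathlib `gaussSum_sq`);
* `natCast_mul_mem_gaussSum_mul_periodLattice_charTwist_of_modularParametrizationData` — the same in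
  the binders of the crux K (`D : ModularParametrizationData W (N_W)`, `p² ∣ N_W`, `χ` primitive quadratic mod
  `p`): `p · Λ(f_W) ⊆ g(χ) · Λ(f_W ⊗ χ)`.

This is the `{1, p, p²}` trichotomy frame from which both registered stubs of the LINE-11 skeleton on K
(`stub_dichotomy`, `stub_noCaseOne`: Edixhoven 1991 §4) start; K itself (which member of the frame occurs)
is NOT proved here. BSD is not proved by this; no item is closed by this file.
-/

set_option autoImplicit false

noncomputable section

open scoped MatrixGroups ModularForm

open CongruenceSubgroup

open Literature.NumberTheory.EllipticCurves Literature.NumberTheory.EllipticCurves.ModularForms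

-- D-0017: single-problem summit, so `Summit.BirchSwinnertonDyer.BirchSwinnertonDyer.…` repeats a namespace BY DESIGN.
set_option linter.dupNamespace false

namespace Summit.BirchSwinnertonDyer.BirchSwinnertonDyer.Theorems.TeichmullerTwistDescent.TwistedPeriodLatticeIndexFrame

variable {N : ℕ} [NeZero N] {k : ℤ} {m : ℕ} [NeZero m]

/-- A value of a quadratic character (`∈ {0, ±1}`) times an element of an additive subgroup of `ℂ` stays
in the subgroup. [folklore] -/
theorem quadratic_apply_mul_mem {χ : DirichletCharacter ℂ m} (hχ : χ.IsQuadratic) (u : ZMod m)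
    {Λ : AddSubgroup ℂ} {z : ℂ} (hz : z ∈ Λ) : χ u * z ∈ Λ := by
  by_cases hu : IsUnit u
  · rcases sq_eq_one_iff.mp (apply_sq_eq_one_of_isQuadratic hχ hu) with h1 | h1
    · rw [h1, one_mul]
      exact hz
    · rw [h1, neg_one_mul]
      exact neg_mem hz
  · rw [χ.map_nonunit hu, zero_mul]
    exact zero_mem _

/-- A primitive Dirichlet character of modulus `m ≠ 1` is not the trivial character. [folklore] -/
theorem ne_one_of_isPrimitive {χ : DirichletCharacter ℂ m} (hprim : χ.IsPrimitive) (hm1 : m ≠ 1) :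
    χ ≠ 1 := by
  rintro rfl
  rw [DirichletCharacter.isPrimitive_def, DirichletCharacter.conductor_one] at hprim
  exact hm1 hprim.symm

/-- **`g(χ)² = χ(−1) · p`** for a primitive quadratic Dirichlet character `χ` mod a prime `p` and the
standard additive character (Mathlib `gaussSum_sq`, finite-field case). [folklore] -/
theorem gaussSum_stdAddChar_sq {p : ℕ} [Fact p.Prime] {χ : DirichletCharacter ℂ p} (hχ : χ.IsQuadratic)
    (hprim : χ.IsPrimitive) :
    gaussSum χ (ZMod.stdAddChar (N := p)) ^ 2 = χ (-1) * (p : ℂ) := by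
  have hp : p.Prime := Fact.out
  have hψ : AddChar.IsPrimitive (ZMod.stdAddChar (N := p)) := ZMod.isPrimitive_stdAddChar p
  have hne : χ ≠ 1 := ne_one_of_isPrimitive hprim hp.ne_one
  have h : gaussSum χ (ZMod.stdAddChar (N := p)) ^ 2 = χ (-1) * (Fintype.card (ZMod p) : ℂ) :=
    gaussSum_sq hne hχ hψ
  rw [ZMod.card p] at h
  exact h

/-- **The quadratic twist is an involution** on the forms whose Fourier coefficients vanish at every index
that is not a unit mod `m`: `(f ⊗ χ) ⊗ χ = f` for `χ` primitive quadratic mod `m`, `m² ∣ N` (both sides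
have the `q`-expansion `∑ χ(n)² aₙ(f) qⁿ`, and `χ(n)² = 1` on units, `aₙ(f) = 0 = χ(n)` off units).
[cite: Shimura1971, Prop. 3.64] -/
theorem charTwist_charTwist_eq_self_of_cuspCoeff_eq_zero (hm : m ^ 2 ∣ N) {χ : DirichletCharacter ℂ m}
    (hχ : χ.IsQuadratic) (hprim : χ.IsPrimitive) (f : CuspForm (Gamma0 N) k)
    (h0 : ∀ n : ℕ, ¬ IsUnit ((n : ℕ) : ZMod m) → cuspCoeff f n = 0) :
    charTwist N (dvd_refl N) hm hχ (charTwist N (dvd_refl N) hm hχ f) = f := by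
  refine eq_of_forall_cuspCoeff_eq_gamma0 fun n ↦ ?_
  rw [cuspCoeff_charTwist N (dvd_refl N) hm hχ hprim, cuspCoeff_charTwist N (dvd_refl N) hm hχ hprim,
    ← mul_assoc, ← sq]
  by_cases hu : IsUnit ((n : ℕ) : ZMod m)
  · rw [apply_sq_eq_one_of_isQuadratic hχ hu, one_mul]
  · rw [h0 n hu, mul_zero]

/-- **For a weight-2 newform of level `N` with `p² ∣ N`: `aₙ(f) = 0` whenever `p ∣ n`** (`a_p = 0`, Atkin–Lehner 1970
Thm. 3, hence `a_{p^e} = 0` for `e ≥ 1`, and multiplicativity on coprime indices). [cite: AtkinLehner1970, Thm. 3] -/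
theorem cuspCoeff_eq_zero_of_isNewform0_of_sq_dvd_of_dvd {f : CuspForm (Gamma0 N) 2} (hf : IsNewform0 f)
    {p : ℕ} (hp : p.Prime) (hp2 : p ^ 2 ∣ N) {n : ℕ} (hn : p ∣ n) : cuspCoeff f n = 0 := by
  rcases Nat.eq_zero_or_pos n with rfl | hn0
  · exact cuspCoeff_zero_eq f
  obtain ⟨a, b, hb, rfl⟩ := Nat.exists_eq_pow_mul_and_not_dvd hn0.ne' p hp.ne_one
  have ha : a ≠ 0 := by
    rintro rfl
    rw [pow_zero, one_mul] at hn
    exact hb hn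
  obtain ⟨a, rfl⟩ := Nat.exists_eq_succ_of_ne_zero ha
  have hcop : (p ^ (a + 1)).Coprime b := (hp.coprime_iff_not_dvd.mpr hb).pow_left _
  have hmul : cuspCoeff f (p ^ (a + 1) * b) = cuspCoeff f (p ^ (a + 1)) * cuspCoeff f b :=
    IsNewform0.coeff_mul_of_coprime_holds hf hcop
  rw [hmul, hf.cuspCoeff_prime_pow_eq_zero_of_sq_dvd hp hp2 a, zero_mul]

/-- **The index frame `p · Λ(f) ⊆ g(χ) · Λ(f ⊗ χ)`** (weight 2): for `χ` primitive quadratic mod a prime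
`p`, `p² ∣ N`, and `f ∈ S₂(Γ₀(N))` with `aₙ(f) = 0` whenever `p ∣ n`, every period `z ∈ Λ(f)` has
`p · z = g(χ) · w` for some period `w` of the twist `f ⊗ χ`. Proof: `(f ⊗ χ) ⊗ χ = f`, so the tree's twisting
lemma (Stevens 1989 (5.4), `gaussSum_mul_mem_periodLattice_of_mem_charTwist`) applied to `f ⊗ χ` gives
`g(χ) z ∈ Λ(f ⊗ χ)`; take `w = χ(−1) g(χ) z` and use `g(χ)² = χ(−1) p`. With the twisting lemma itself
(`g(χ) Λ(f ⊗ χ) ⊆ Λ(f)`) the index `[Λ(f) : g(χ) Λ(f ⊗ χ)]` divides `p²`. [cite: Stevens1989, Lemma (5.4)] -/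
theorem natCast_mul_mem_gaussSum_mul_periodLattice_charTwist {p : ℕ} [Fact p.Prime] (hp2 : p ^ 2 ∣ N)
    {χ : DirichletCharacter ℂ p} (hχ : χ.IsQuadratic) (hprim : χ.IsPrimitive) (f : CuspForm (Gamma0 N) 2)
    (h0 : ∀ n : ℕ, p ∣ n → cuspCoeff f n = 0) {z : ℂ} (hz : z ∈ periodLattice f) :
    ∃ w ∈ periodLattice (charTwist N (dvd_refl N) hp2 hχ f),
      (p : ℂ) * z = gaussSum χ (ZMod.stdAddChar (N := p)) * w := by
  have hp : p.Prime := Fact.out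
  have h0' : ∀ n : ℕ, ¬ IsUnit ((n : ℕ) : ZMod p) → cuspCoeff f n = 0 := by
    intro n hn
    refine h0 n ?_
    by_contra hpn
    exact hn ((ZMod.isUnit_iff_coprime n p).mpr (Nat.coprime_comm.mp (hp.coprime_iff_not_dvd.mpr hpn)))
  set F := charTwist N (dvd_refl N) hp2 hχ f with hF
  have hFF : charTwist N (dvd_refl N) hp2 hχ F = f :=
    charTwist_charTwist_eq_self_of_cuspCoeff_eq_zero hp2 hχ hprim f h0'
  have hz' : z ∈ periodLattice (charTwist N (dvd_refl N) hp2 hχ F) := by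
    rw [hFF]
    exact hz
  have hg : gaussSum χ (ZMod.stdAddChar (N := p)) * z ∈ periodLattice F :=
    gaussSum_mul_mem_periodLattice_of_mem_charTwist N (dvd_refl N) hp2 hχ hprim F hz'
  refine ⟨χ (-1) * (gaussSum χ (ZMod.stdAddChar (N := p)) * z), quadratic_apply_mul_mem hχ (-1) hg, ?_⟩
  have hsq := gaussSum_stdAddChar_sq hχ hprim
  have h1 : χ (-1) ^ 2 = 1 := apply_sq_eq_one_of_isQuadratic hχ isUnit_one.neg
  calc (p : ℂ) * z = (χ (-1) ^ 2) * (p : ℂ) * z := by rw [h1, one_mul]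
    _ = χ (-1) * (gaussSum χ (ZMod.stdAddChar (N := p)) ^ 2) * z := by rw [hsq]; ring
    _ = gaussSum χ (ZMod.stdAddChar (N := p)) * (χ (-1) * (gaussSum χ (ZMod.stdAddChar (N := p)) * z)) := by
          ring

/-- **The index frame in the binders of crux K** (`TwistedPeriodLatticeSaturation`, stmt-25368): for an
elliptic `W/ℚ`, an `X₀(N_W)`-datum `D` of `W` (so `D.f` is the newform of `W`, level `N_W`), a prime `p` with
`p² ∣ N_W` and `χ` primitive quadratic mod `p`: `p · Λ(f_W) ⊆ g(χ) · Λ(f_W ⊗ χ)` — every `z ∈ Λ(D.f)` is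
`g(χ) w / p` for a period `w` of the twist. (`a_n(f_W) = 0` for `p ∣ n` since `p² ∣ N_W`.) With the tree's
`g(χ) Λ(f_W ⊗ χ) ⊆ Λ(f_W)` the index `[Λ(f_W) : g(χ) Λ(f_W ⊗ χ)] ∈ {1, p, p²}`; K asserts it is `1` on the
potentially ordinary irreducible low-valuation rows — not proved here. [cite: Stevens1989, Lemma (5.4)]
[cite: AtkinLehner1970, Thm. 3] -/
theorem natCast_mul_mem_gaussSum_mul_periodLattice_charTwist_of_modularParametrizationData
    (W : WeierstrassCurve ℚ) (p : ℕ) [Fact p.Prime] [NeZero (W.conductorNorm ℤ)]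
    (D : ModularParametrizationData W (W.conductorNorm ℤ)) (hsq : p ^ 2 ∣ W.conductorNorm ℤ)
    (χ : DirichletCharacter ℂ p) (hχ : χ.IsQuadratic) (hprim : χ.IsPrimitive)
    {z : ℂ} (hz : z ∈ periodLattice D.f) :
    ∃ w ∈ periodLattice (charTwist (W.conductorNorm ℤ) (dvd_refl _) hsq hχ D.f),
      (p : ℂ) * z = gaussSum χ (ZMod.stdAddChar (N := p)) * w :=
  natCast_mul_mem_gaussSum_mul_periodLattice_charTwist hsq hχ hprim D.f
    (fun _ hn ↦ cuspCoeff_eq_zero_of_isNewform0_of_sq_dvd_of_dvd D.isNewformOf.1 Fact.out hsq hn) hz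

end Summit.BirchSwinnertonDyer.BirchSwinnertonDyer.Theorems.TeichmullerTwistDescent.TwistedPeriodLatticeIndexFrame

end
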